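import Summits.QuantumFields.YangMills.Theorems.F4SubCurvatureDoorShortRootRigiditySliceInClass
import Mathlib
import HarnessLib

/-!
# LINE g20-A «angular type» — FIRST RUNGS, by name (v2: + S2 `PlanarExponentialMoments`; R0/R1⁺/R1 proved) (targets for `--supports stmt-QuantumFields-23035`)

Owner file of ideator seat `ym-idea-3` (g20) for the registered skeleton `Lines/angular_type.lean` (crux
`F4SubCurvatureDoor.ShortRootRigidity` ⟨stmt-QuantumFields-23035⟩).  It states, as named `Prop`s over the REGISTERED
planar vocabulary (`E2`, `InPlanarClass` of `Theorems/F4SubCurvatureDoorShortRootRigiditySlice{Density,InClass}.lean`), the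
first lemmas of the plan for the load-bearing stub `stub_planarSpectralCone` (card `Lines/angular_type.md`, §Hardest stub,
steps S1–S2).  All three are BUDGET-FREE and use only: continuity off `0`, boundedness at infinity, `D₆`-invariance and
reflection positivity across `y₀ = 0` (hence across the three short-root mirrors at 30°/90°/150°, time axes 0°/±60°).

* `PlanarFrameTimeHolomorphy` (R0, size S–M): complex translation along a frame's time axis — for `y₀ ≠ 0` the function
  `u ↦ k(y₀ + u, y₁)` is on `(-|y₀|, |y₀|)` the trace of a function holomorphic on the disc of radius `|y₀|`, bounded there by
  the axis value `k(y₀ + Re u, 0)`.  Source: the one-mirror lemma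
  `Literature.MathematicalPhysics.QuantumFieldTheory.MirrorSlabTranslationHolomorphy` / the planar Laplace–Fourier measure
  (OS contraction semigroup + Cauchy–Schwarz); the other two frames follow by `D₆`-invariance.
* `PlanarConicChart` (R1⁺, size M): at every `y ≠ 0` the kernel is the real trace of ONE function holomorphic on the complex
  polydisc of radius `c‖y‖` around `y`, bounded by any bound of `|k|` on `{‖y'‖ ≥ c‖y‖}`.  Proof plan: for every `y ≠ 0` at least
  TWO of the three frame directions `n_θ` (`θ = 0, ±60°`) have `|y · n_θ| ≥ ‖y‖/2`; R0 in those two frames gives the separate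
  one-variable extensions (radius `‖y‖/6`, common bound) at all nearby real points; Bernstein's local cross theorem
  `Literature.Analysis.Complex.exists_holomorphic_extension_of_separately_three_local` (dummy third variable; the radius of the
  joint polydisc depends on `ℓ` only, so dilation gives `c‖y‖`) yields the joint extension with the same bound.  THIS IS WHERE
  THE 60° GEOMETRY IS LOAD-BEARING: for two perpendicular frames the statement is false on the axes
  (`k = e^{-m|y₀|} e^{-m|y₁|}` is `B₂`-symmetric, reflection positive in both axes, and kinked on them).
* `PlanarAnalyticOffZero` (R1, size S given R1⁺): `k` is real-analytic on `E2 ∖ {0}` (chart lemma, cf.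
  `Literature.Analysis.Complex.analyticAt_of_holomorphic_chart`).

Downstream (not stated here): R1⁺ at the ray points `(t, 0)` + Lukacs
(`Literature.Analysis.Complex.LaplaceFourierCone.integral_exp_le_of_laplaceFourier_eq_on_ball`) ⇒ exponential moments of order
`c t` for the spatial measures (initial tube aperture, S2); the equal-aperture edge bootstrap (S3) and support pinning (S4) then
give `PlanarSpectralCone`.  R1 is also the «restore-first structure» named in LINE g19-A's §P1 (analyticity off `0`), so it
serves both registered lines.  Nothing here is proved; no summit and no rung of LADDER-YM is claimed.

v2 (g21, 2026-08-29): STATUS — R0 `PlanarFrameTimeHolomorphy` PROVED by name (✓p714310, free hand `ym-line-frs-p2` g15), R1⁺ `PlanarConicChart`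
and R1 `PlanarAnalyticOffZero` PROVED (kernel-checked combined file, evidence #17/#18 on ⟨stmt-QuantumFields-23035⟩; Theorems files
`…PlanarFrames`, `…PlanarAnalyticOffZero`, `…PlanarConicChart` in the proposal pipeline behind ✓p714132/✓p714310).  NEW BY-NAME TARGET, typed at the
free hand's request (INBOX 11:12:40Z) character-identically to the statement it has already kernel-checked as a helper (11:17:00Z):
* `PlanarExponentialMoments` (S2 «initial tube aperture», size M given R1⁺): for `k ∈ InPlanarClass` there is `c > 0` (the R1⁺ chart constant)
  such that EVERY planar Laplace–Fourier representing measure `μ` of the frame (hypothesis shape = conclusion of ✓p714132 `exists_planarLF`)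
  has exponential moments of aperture `c`: for `t > 0`, `|β| < c t`, `e^{−tE+βp} ∈ L¹(μ)` and `∫ e^{−tE+βp} dμ ≤ 2M` for every bound `M` of `|k|`
  on `{‖y'‖ ≥ c t}` (R1⁺ at the ray point `(t,0)` + the tree's Lukacs lemma `Literature.Analysis.Complex.integral_exp_le_of_laplaceFourier_eq_on_ball`
  applied to the symmetrised tilted finite measure; factor 2 from symmetrisation).  Equivalent currency: the frame transform
  `(ζ,σ) ↦ ∫ e^{−ζE+iσp} dμ` is holomorphic on the NARROW tube-cone `{Re ζ > 0, |Im σ| < c·Re ζ}`.  The remaining content of (C)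
  `stub_planarSpectralCone` is S3 (aperture bootstrap `c ↑ 1` — the 60° step: the six frame tube-cones `R_j{Re ζ > 0, |Im σ| < c Re ζ}` are convex,
  pairwise overlapping along real sectors, and their union is NOT pseudoconvex at the «armpit» points `Im z ∈ ∂(strip₀ ∪ strip_{60°})`, so `k`
  continues across them (Levi extension); computing how far = the XL heart; NOT pre-typed: an «aperture 1 with the sharp bound
  ∫e^{−tE}cosh(βp)dμ ≤ k(t−|β|, 0)» statement is already equivalent to (C) by the easy pinning argument `t → ∞` (S4), so no honest
  intermediate Prop short of (C) is known to the owner) and S4 (support pinning, S given S3's sharp bound).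
-/

noncomputable section

namespace Summit.QuantumFields.YangMills.Cruxes.ShortRootRigidity.AngularTypeRungs

open scoped Topology
open Set MeasureTheory
open Summit.QuantumFields.YangMills.Theorems.F4SubCurvatureDoorSliceDensityRegistered (E2)
open Summit.QuantumFields.YangMills.Theorems.F4SubCurvatureDoorSliceInClassRegistered (InPlanarClass)

/-- The point `(a, b)` of the plane (same text as `Lines/angular_type.lean`'s `mk2`). [problem-side definition] -/
def mk2 (a b : ℝ) : E2 := (WithLp.equiv 2 (Fin 2 → ℝ)).symm ![a, b]

/-- **R0 · PlanarFrameTimeHolomorphy** (target, S–M; budget-free).  Complex translation along the frame-`0` time axis: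
for `k ∈ InPlanarClass` and `y` off the mirror `y₀ = 0`, `u ↦ k(y₀ + u, y₁)` extends holomorphically to the disc
`|u| < |y₀|`, with the axis bound `‖g(w)‖ ≤ k(y₀ + Re w, 0)` (OS contraction semigroup + Cauchy–Schwarz; for `y₀ < 0` use
the time reflection in `D₆`).  Frames `±60°` follow by `D₆`-invariance.
[target; sources: OsterwalderSchrader1973 §4, GlimmJaffe1987 Thm. 6.1.3; tree: MirrorSlabTranslationHolomorphy] -/
def PlanarFrameTimeHolomorphy : Prop :=
  ∀ k : E2 → ℝ, InPlanarClass k → ∀ y : E2, y 0 ≠ 0 →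
    ∃ g : ℂ → ℂ, DifferentiableOn ℂ g (Metric.ball (0 : ℂ) |y 0|) ∧
      (∀ u : ℝ, |u| < |y 0| → g u = k (mk2 (y 0 + u) (y 1))) ∧
      ∀ w ∈ Metric.ball (0 : ℂ) |y 0|, ‖g w‖ ≤ k (mk2 (y 0 + w.re) 0)

/-- **R1⁺ · PlanarConicChart** (target, M; budget-free; the quantitative form S2 consumes).  There is `c > 0` (depending on
`k` only through nothing — in fact universal, but stated per `k`) such that at every `y ≠ 0` the kernel is, on the real points
of the complex polydisc of radius `c‖y‖` around `y`, the trace of a function holomorphic on that polydisc and bounded there by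
ANY bound of `|k|` on `{y' : c‖y‖ ≤ ‖y'‖}`.  Plan: two frames with `|y · n_θ| ≥ ‖y‖/2` + R0 + Bernstein's local cross theorem
`Literature.Analysis.Complex.exists_holomorphic_extension_of_separately_three_local` + dilation.
[target; sources: JarnickiPflug2011 Ch. 5; Bernstein 1912] -/
def PlanarConicChart : Prop :=
  ∀ k : E2 → ℝ, InPlanarClass k → ∃ c : ℝ, 0 < c ∧ ∀ y : E2, y ≠ 0 →
    ∃ F : ℂ × ℂ → ℂ,
      DifferentiableOn ℂ F (Metric.ball ((((y 0 : ℝ) : ℂ), ((y 1 : ℝ) : ℂ)) : ℂ × ℂ) (c * ‖y‖)) ∧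
      (∀ a b : ℝ, |a - y 0| < c * ‖y‖ → |b - y 1| < c * ‖y‖ → F ((a : ℂ), (b : ℂ)) = k (mk2 a b)) ∧
      ∀ M : ℝ, (∀ y' : E2, c * ‖y‖ ≤ ‖y'‖ → |k y'| ≤ M) →
        ∀ w ∈ Metric.ball ((((y 0 : ℝ) : ℂ), ((y 1 : ℝ) : ℂ)) : ℂ × ℂ) (c * ‖y‖), ‖F w‖ ≤ M

/-- **R1 · PlanarAnalyticOffZero** (target, S given R1⁺; budget-free).  Every kernel of the hexagonal planar class is
real-analytic off the origin.  (From R1⁺ by a two-variable chart lemma in the manner of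
`Literature.Analysis.Complex.analyticAt_of_holomorphic_chart`.)  Also the «restore-first structure» of LINE g19-A §P1.
[target; sources: JarnickiPflug2011 Ch. 5; OsterwalderSchrader1975] -/
def PlanarAnalyticOffZero : Prop :=
  ∀ k : E2 → ℝ, InPlanarClass k → AnalyticOnNhd ℝ k {y : E2 | y ≠ 0}

/-- S2 «INITIAL TUBE APERTURE / EXPONENTIAL MOMENTS» (size M given R1⁺; typed character-identically to the free hand's kernel-checked helper
`planarExponentialMoments`, INBOX 2026-08-29T11:12:40Z/11:17:00Z): every planar Laplace–Fourier representing measure of a frame of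
`k ∈ InPlanarClass` has exponential moments of aperture `c` (the R1⁺ chart constant), bounded by twice any bound of `|k|` on `{‖y'‖ ≥ c t}`.
[problem-side rung; Lukacs via `Literature.Analysis.Complex.integral_exp_le_of_laplaceFourier_eq_on_ball`] -/
def PlanarExponentialMoments : Prop := ∀ k : E2 → ℝ, InPlanarClass k → ∃ c : ℝ, 0 < c ∧ ∀ μ : Measure (ℝ × ℝ), μ (Set.Iio 0 ×ˢ Set.univ) = 0 → (∀ t : ℝ, 0 < t → Integrable (fun z : ℝ × ℝ => Real.exp (-(t * z.1))) μ ∧ ∀ x : ℝ, k (mk2 t x) = ∫ z, Real.exp (-(z.1 * t)) * Real.cos (z.2 * x) ∂μ) → ∀ t β : ℝ, 0 < t → |β| < c * t → Integrable (fun z : ℝ × ℝ => Real.exp (-(t * z.1) + β * z.2)) μ ∧ ∀ M : ℝ, (∀ y' : E2, c * t ≤ ‖y'‖ → |k y'| ≤ M) → ∫ z, Real.exp (-(t * z.1) + β * z.2) ∂μ ≤ 2 * M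


/-! ## v3 (g21, 2026-08-29 ~13:40Z): the S3 «BOOTSTRAP TO THE LIGHT CONE» engine, typed — and its local SCV step made ELEMENTARY

The card's step S3 (§Hardest stub) needs, at the critical points `z⋆(t) = (t, iτt)` where the three frame tubes of aperture `τ < 1` have
ℂ-independent conormals (`det = (τ² − 1)·sin(θ′ − θ)`; kernel-checked 4-D analogue: `Cruxes/RationalToGeneral/DiagonalEdgeMinors.lean`),
a LOCAL BOCHNER TUBE THEOREM for the flat «L-shaped» configuration `{Im w₁ > 0} ∪ {Im w₂ > 0} ⊂ ℂ²` WITH A SUP BOUND (the bound is what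
turns «exponential moments for every t» into SUPPORT via pinning as `t → ∞`; finiteness alone does not).  Two observations of this version:

1. (EXISTENCE from the tree.)  The unbounded statement follows from the tree's NAMED FACT `Literature.Analysis.Complex.edgeOfTheWedge`
   (Streater–Wightman Thm 2-16; cone `𝒞 = Q₂ = {y₁ < 0 < y₂}`, so that `V + i𝒞 ⊂ {Im w₂ > 0}` and `V − i𝒞 ⊂ {Im w₁ > 0}`) together with the
   PROVED `Literature.Analysis.Distribution.tendsto_integral_of_norm_le_inv_pow` (Hörmander Thm 3.1.15, exponent `N = 0` for bounded `f`):
   the boundary values from `Q₂ ⊂ {y₂ > 0}` and from `Q₄ ⊂ {y₁ > 0}` exist and both equal the boundary value taken inside `Q₁ ⊂` both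
   half-spaces (uniqueness of limits along the sub-filter `𝓝[Q₁] 0`).  No Komatsu / Kato–Struppa typing job is needed for existence.
2. (BOUND, elementary.)  The bounded model statement `FlatDoubleEdgeModel` below has a self-contained proof by ONE explicit family of analytic
   discs: `φ_q(λ) = q + (λ, −λ + i c λ²)`.  For `λ = x + iy ≠ 0` small, `Im φ_q(λ) = (Im q₁ + y, Im q₂ − y + c(x² − y²))`, and on the circle
   `|λ| = r` (with `c r = 1/8`, `|Im q₁| + |Im q₂| < c r²/4`) one of the two coordinates has positive imaginary part — if `sin θ > |Im q₁|/r` the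
   first, if `sin θ ≤ −1/2` the second (`−y ≥ r/2` dominates), and in between `cos 2θ ≥ 1/2` makes `c r² cos 2θ/2` dominate.  Hence
   `G(q) := (2πi)⁻¹ ∮_{|λ|=r} f(φ_q(λ)) dλ/λ` is holomorphic on the polydisc `{|Im q| < c r²/8, |Re q| small}` (holomorphic parameter integral),
   `‖G‖ ≤ M` (mean of values `≤ M`), and `G = f` where the closed disc lies in the domain (e.g. `Im q₁ > r`: mean-value property), hence on the
   whole (connected: union of two convex sets meeting) intersection by the identity theorem.  Size M, Mathlib only (`circleIntegral`,
   `hasFDerivAt_integral_of_dominated_of_fderiv_le`, `AnalyticOnNhd.eqOn_of_preconnected_of_eventuallyEq`).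
With the local step in hand, S3 is: aperture `τ` (support form) ⇒ `k` holomorphic on the three frame tubes of aperture `τ` with the pinning
bound ⇒ (`FlatDoubleEdge` at `z⋆(t)`, radius `∝ t`, `δ ∝ t`) holomorphic and bounded by `2M` on the discs `|b ∓ iτt| < δ₁ t` of the line `ζ = t`
⇒ (Lukacs: `Literature.Analysis.Complex.integral_exp_le_of_laplaceFourier_eq_on_ball`, as in S2) exponential moments of aperture `τ + δ′` bounded
by `2M` for every `t` ⇒ (pinning as `t → ∞`, `k` bounded outside the unit disc) aperture `τ + δ′` in support form = `PlanarApertureStep`; and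
`planarConeSupport_of_step` (PROVED below: the set of valid apertures is closed under suprema by continuity of measure, so its supremum is
`1`) turns initial aperture + step into the cone `μ{E < |p|} = 0`, from which (C) `PlanarSpectralCone k` is the tree's tube packaging
(`planarNarrowTube` with `c = 1` and the cone majorant, S4 of the card).  THE SAME ENGINE, run on the Gaussian slices in the four A₂-planes,
is `Cruxes/RationalToGeneral/Lines/forward_cone_rungs.lean`'s `DiagonalGain` (⟨23125⟩ S1): one proof serves both cruxes.
HONEST LABEL: typed targets + one proved reduction; (C), S3, ⟨23035⟩, ⟨23125⟩ OPEN; no summit is proved by a line. -/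

/-- **R-S3a · FlatDoubleEdgeModel** (target, M, Mathlib-only; the local Bochner tube theorem for the L-shaped base WITH the sup bound, unit
scale at the origin of `ℂ × ℂ` (sup norm)): a bounded holomorphic function on `{‖w‖ < 1} ∩ ({Im w₁ > 0} ∪ {Im w₂ > 0})` extends
holomorphically, with the same bound, to the ball of radius `δ` (a constant of geometry, independent of `f`).  Proof: the disc family
`φ_q(λ) = q + (λ, −λ + icλ²)` of the section docstring.  [Komatsu 1972 (local tube theorem); Kato–Struppa 2020 Thm 1.4.1; here elementary] -/
def FlatDoubleEdgeModel : Prop :=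
  ∃ δ : ℝ, 0 < δ ∧ ∀ (f : ℂ × ℂ → ℂ) (M : ℝ),
    DifferentiableOn ℂ f {w : ℂ × ℂ | ‖w‖ < 1 ∧ (0 < w.1.im ∨ 0 < w.2.im)} →
    (∀ w : ℂ × ℂ, ‖w‖ < 1 → (0 < w.1.im ∨ 0 < w.2.im) → ‖f w‖ ≤ M) →
    ∃ g : ℂ × ℂ → ℂ, DifferentiableOn ℂ g (Metric.ball 0 δ) ∧ (∀ w ∈ Metric.ball (0 : ℂ × ℂ) δ, ‖g w‖ ≤ M) ∧
      ∀ w ∈ Metric.ball (0 : ℂ × ℂ) δ, (0 < w.1.im ∨ 0 < w.2.im) → g w = f w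

/-- **R-S3b · FlatDoubleEdge** (target, S given R-S3a: an invertible ℂ-linear change of coordinates, a translation and a dilation): for two
ℂ-linearly independent functionals `l₁, l₂` on `ℂ²` there is `δ₁ > 0` such that every bounded holomorphic function on
`{‖z − p‖ < r} ∩ ({Im l₁(z − p) > 0} ∪ {Im l₂(z − p) > 0})` extends holomorphically, with the same bound, to the ball `‖z − p‖ < δ₁ r` — `δ₁`
depends on `l₁, l₂` only (NOT on `p`, `r`, `f`: this uniformity is what makes the aperture gain linear in `t`).  Every real half-space through
`p` is `{Im l(z − p) > 0}` for a unique ℂ-linear `l` (`Re(λ·z) = Im(iλ·z)`); «ℂ-independent conormals» is the hypothesis. [as R-S3a] -/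
def FlatDoubleEdge : Prop :=
  ∀ (l₁ l₂ : (ℂ × ℂ) →L[ℂ] ℂ), LinearIndependent ℂ ![l₁, l₂] →
    ∃ δ₁ : ℝ, 0 < δ₁ ∧ ∀ (p : ℂ × ℂ) (r : ℝ), 0 < r → ∀ (f : ℂ × ℂ → ℂ) (M : ℝ),
      DifferentiableOn ℂ f {z : ℂ × ℂ | ‖z - p‖ < r ∧ (0 < (l₁ (z - p)).im ∨ 0 < (l₂ (z - p)).im)} →
      (∀ z : ℂ × ℂ, ‖z - p‖ < r → (0 < (l₁ (z - p)).im ∨ 0 < (l₂ (z - p)).im) → ‖f z‖ ≤ M) →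
      ∃ g : ℂ × ℂ → ℂ, DifferentiableOn ℂ g (Metric.ball p (δ₁ * r)) ∧ (∀ z ∈ Metric.ball p (δ₁ * r), ‖g z‖ ≤ M) ∧
        ∀ z ∈ Metric.ball p (δ₁ * r), (0 < (l₁ (z - p)).im ∨ 0 < (l₂ (z - p)).im) → g z = f z

/-- A planar Laplace–Fourier representing measure of the frame-`0` transform of `k` (the binder shape of `PlanarExponentialMoments` and of
`Theorems.F4SubCurvatureDoorShortRootRigidityPlanarNarrowTube.planarNarrowTube`, named). [problem-side vocabulary] -/
def IsPlanarLF (k : E2 → ℝ) (μ : Measure (ℝ × ℝ)) : Prop :=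
  μ (Set.Iio 0 ×ˢ Set.univ) = 0 ∧
    ∀ t : ℝ, 0 < t → Integrable (fun z : ℝ × ℝ => Real.exp (-(t * z.1))) μ ∧
      ∀ x : ℝ, k (mk2 t x) = ∫ z, Real.exp (-(z.1 * t)) * Real.cos (z.2 * x) ∂μ

/-- Aperture `τ` in SUPPORT form: no Laplace–Fourier mass strictly below the cone of slope `τ`. [problem-side vocabulary] -/
def HasAperture (μ : Measure (ℝ × ℝ)) (τ : ℝ) : Prop :=
  μ {z : ℝ × ℝ | z.1 < τ * |z.2|} = 0

/-- **R-S3c · PlanarInitialAperture** (target, S given the tree: `planarExponentialMoments` ✓ gives moments of aperture `c` bounded by `2M`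
for EVERY `t`, and pinning as `t → ∞` (`k` bounded outside the unit disc; pattern `Cruxes/RationalToGeneral/Lines/forward_cone_rungs.lean`
`aperture_of_forall_lt`) converts them into support form). -/
def PlanarInitialAperture : Prop :=
  ∀ k : E2 → ℝ, InPlanarClass k → ∃ c : ℝ, 0 < c ∧ ∀ μ : Measure (ℝ × ℝ), IsPlanarLF k μ → HasAperture μ c

/-- **R-S3d · PlanarApertureStep** (target, L — THE S3 STEP): below slope `1`, every valid aperture improves, by an amount that may depend on
`τ` but NOT on `k`, `μ`, `t`.  Proof plan (section docstring): three frame tubes of aperture `τ` (D₆: the SAME `μ`-aperture in the frames at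
`±60°`, by `hexReflection`/rotation invariance of `InPlanarClass` and uniqueness of the frame measure) ⇒ `FlatDoubleEdge` at `(t, ±iτt)` with the
pinning bound ⇒ Lukacs on the line `ζ = t` ⇒ moments of aperture `τ + δ′` bounded by `2M` for all `t` ⇒ pinning.  At `τ = 1` the conormals are
ℂ-proportional and the light cone IS a natural boundary (`K₀(m‖y‖)`), so the hypothesis `τ < 1` is sharp.  WHY IT MIGHT FAIL: it should not;
the one delicate point is the identification of the three frame transforms as ONE holomorphic function on the union of the tubes (identity
theorem on the pairwise intersections, which are convex hence connected, through the common real sector). -/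
def PlanarApertureStep : Prop :=
  ∀ τ : ℝ, 0 < τ → τ < 1 → ∃ τ' : ℝ, τ < τ' ∧
    ∀ (k : E2 → ℝ) (μ : Measure (ℝ × ℝ)), InPlanarClass k → IsPlanarLF k μ → HasAperture μ τ → HasAperture μ τ'

/-- **PlanarConeSupport** (the support form of (C)): the frame Laplace–Fourier measure of a planar class kernel is carried by the forward light
cone `{E ≥ |p|}`.  (C) `PlanarSpectralCone k` is its tube packaging (card S4; `planarNarrowTube`'s proof with `c = 1` and the cone majorant). -/
def PlanarConeSupport : Prop :=
  ∀ (k : E2 → ℝ) (μ : Measure (ℝ × ℝ)), InPlanarClass k → IsPlanarLF k μ → HasAperture μ 1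

theorem hasAperture_mono {μ : Measure (ℝ × ℝ)} {σ τ : ℝ} (h : HasAperture μ τ) (hστ : σ ≤ τ) : HasAperture μ σ := by
  refine measure_mono_null (fun z hz => ?_) h
  simp only [Set.mem_setOf_eq] at hz ⊢
  exact lt_of_lt_of_le hz (mul_le_mul_of_nonneg_right hστ (abs_nonneg _))

/-- Apertures are closed under limits: if every `τ n` is a valid aperture and `τ n → τ⋆`, then `τ⋆` is one (the strict sub-cone of slope
`τ⋆` is the union of the sub-cones of slopes `τ n`, by continuity of measure). -/
theorem hasAperture_of_tendsto {μ : Measure (ℝ × ℝ)} {τ : ℕ → ℝ} {τs : ℝ} (h : ∀ n, HasAperture μ (τ n))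
    (hlim : Filter.Tendsto τ Filter.atTop (𝓝 τs)) : HasAperture μ τs := by
  have hsub : {z : ℝ × ℝ | z.1 < τs * |z.2|} ⊆ ⋃ n, {z : ℝ × ℝ | z.1 < τ n * |z.2|} := by
    intro z hz
    simp only [Set.mem_setOf_eq] at hz
    simp only [Set.mem_iUnion, Set.mem_setOf_eq]
    by_cases hp : z.2 = 0
    · refine ⟨0, ?_⟩
      simpa [hp] using hz
    · have hpos : 0 < |z.2| := abs_pos.mpr hp
      -- `z.1 / |z.2| < τs`, so eventually `z.1 / |z.2| < τ n`
      have hlt : z.1 / |z.2| < τs := by rwa [div_lt_iff₀ hpos]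
      have hev : ∀ᶠ n in Filter.atTop, z.1 / |z.2| < τ n := hlim.eventually (eventually_gt_nhds hlt)
      obtain ⟨n, hn⟩ := hev.exists
      exact ⟨n, by rwa [div_lt_iff₀ hpos] at hn⟩
  exact measure_mono_null hsub (measure_iUnion_null fun n => h n)

/-- **The S3 bootstrap, assembled (PROVED): initial aperture + the step below slope `1` ⇒ the light cone.**  The set of valid apertures in
`[0, 1]` contains `min c 1 > 0`, is closed under suprema (`hasAperture_of_tendsto`), and cannot have supremum `< 1` (the step would exceed it). -/
theorem planarConeSupport_of_step (hinit : PlanarInitialAperture) (hstep : PlanarApertureStep) : PlanarConeSupport := by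
  intro k μ hk hμ
  obtain ⟨c, hc, hcμ⟩ := hinit k hk
  have h0 : HasAperture μ (min c 1) := hasAperture_mono (hcμ μ hμ) (min_le_left _ _)
  -- the set of valid apertures in `[0, 1]`
  set T : Set ℝ := {σ : ℝ | σ ≤ 1 ∧ HasAperture μ σ} with hT
  have hTne : T.Nonempty := ⟨min c 1, min_le_right _ _, h0⟩
  have hTbdd : BddAbove T := ⟨1, fun σ hσ => hσ.1⟩
  have hmem : min c 1 ∈ T := ⟨min_le_right _ _, h0⟩
  -- its supremum is a valid aperture
  obtain ⟨u, _, hulim, huT⟩ := exists_seq_tendsto_sSup hTne hTbdd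
  have hsup : HasAperture μ (sSup T) := hasAperture_of_tendsto (fun n => (huT n).2) hulim
  have hsup_le : sSup T ≤ 1 := csSup_le hTne fun σ hσ => hσ.1
  have hsup_pos : 0 < sSup T := lt_of_lt_of_le (lt_min hc one_pos) (le_csSup hTbdd hmem)
  -- and it equals `1`
  by_cases h1 : sSup T < 1
  · exfalso
    obtain ⟨τ', hτ', hstep'⟩ := hstep (sSup T) hsup_pos h1
    have hτ'ap : HasAperture μ (min τ' 1) := hasAperture_mono (hstep' k μ hk hμ hsup) (min_le_left _ _)
    have hmem' : min τ' 1 ∈ T := ⟨min_le_right _ _, hτ'ap⟩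
    have : min τ' 1 ≤ sSup T := le_csSup hTbdd hmem'
    have h2 : sSup T < min τ' 1 := lt_min hτ' h1
    linarith
  · have heq : sSup T = 1 := le_antisymm hsup_le (not_lt.mp h1)
    simpa [PlanarConeSupport, heq] using hsup

end Summit.QuantumFields.YangMills.Cruxes.ShortRootRigidity.AngularTypeRungs

end
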